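import Summits.RiemannHypothesis.RiemannHypothesis.Theorems.HandoffSemilocalEnergy
import Summits.RiemannHypothesis.RiemannHypothesis.Theorems.MotivicDoorSemilocalClosed
import Literature.NumberTheory.LFunctions.WeilWindowSimpleEven
import HarnessLib

/-!
# HANDOFF — the PARITY SPLIT of the semi-local forms: `λ_min(S; a) = min(λ_min(S; a; even), λ_min(S; a; odd))` (cell rh-explicit, TRACK «HANDOFF», seat theory-2)

HONEST FRAMING. Nothing here bears on the truth of RH. HANDOFF-STATEMENT §H.2 records «`ε = min(ε_ev, ε_od)` (tree theorem, for Weil's form);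
"odd carries the wall, even carries the margin" (DATA)» and the A4 wall engines certify SECTOR-wise cells (the binding `oddhalf` = free-odd sector). This
file types the sector structure for EVERY semi-local form `Q_S` (finite set of primes `S`), i.e. for the deficit functionals of every window:

* §1 `W_S` is reflection-invariant and additive on test kernels (`W_S = W + (Pr − Pr_S)` is the tree's `MotivicDoor.Semilocal.weilSemilocalFunctional_eq_weilFunctional_add`) (`weilSemilocalFunctional_comp_neg`, `weilSemilocalFunctional_add`) — the
  polar/archimedean parts are the tree's (`weilPolarTerm_comp_neg`, …), the `S`-restricted prime term only involves `k(log n) + k(−log n)`;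
* §2 the cross terms vanish: `W_S(e ⋆ õ) = 0` for `e` even, `o` odd; **`Q_S(e + o) = Q_S(e) + Q_S(o)`** and `Q_S(g) = Q_S(g_ev) + Q_S(g_od)` —
  Connes–Consani's `QW_λ = QW_λ⁺ ⊕ QW_λ⁻` at the places `S ∪ {∞}` (CC 2023 §2.1.3, Lemma 2.5 (iii)), same proof as the tree's full-form
  `weilQuadratic_add_of_even_odd`;
* §3 **`semilocalGroundEnergy_eq_min_even_odd : λ_min(S; a) = min(λ_min(S; a; even), λ_min(S; a; odd))`** for every `S`, `a` (Suzuki 2026 §4.5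
  (4.10) for Weil's form; here for every `Q_S`), hence the CERTIFICATE SHAPES of the A4 wall cells: `WeilSemilocalPositivityOn S a ↔ 0 ≤ λ_ev(S;a) ∧
  0 ≤ λ_od(S;a)` (two sector certificates ⇒ the window is positive, `a ≤ a*(S)`), and ONE negative sector ⇒ `a*(S) < a` (the free-odd wall cells are
  UPPER clauses for `a*(S)` by themselves).

References: A. Connes, C. Consani, *Spectral triples and ζ-cycles*, Enseign. Math. 69 (2023) 93–148 = arXiv:2106.01715, §2.1.3,
Lemma 2.5 (iii) (p. 14) (`ConnesConsani2023`); M. Suzuki, arXiv:2606.09096, §4.5 eq. (4.10) (arXiv p. 18)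
(`Suzuki2026`); H. Yoshida, Adv. Stud. Pure Math. 21 (1992) Prop. 6 (p. 320) (`Yoshida1992HermitianForms`, the threshold).
-/

set_option linter.dupNamespace false  -- the mandated namespace repeats `RiemannHypothesis`

noncomputable section

open Set Filter Complex MeasureTheory Literature.NumberTheory.LFunctions
open Summit.RiemannHypothesis.RiemannHypothesis.Theorems
open Summit.RiemannHypothesis.RiemannHypothesis.Theorems.HandoffSemilocalEnergy
open Summit.RiemannHypothesis.RiemannHypothesis.Theorems.HandoffAnalytic (summable_weilSemilocalPrimeTerm_summand)
open Summit.RiemannHypothesis.RiemannHypothesis.Theorems.MotivicDoor.SemilocalThreshold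
open Summit.RiemannHypothesis.RiemannHypothesis.Theorems.MotivicDoor.Semilocal (weilSemilocalFunctional_eq_weilFunctional_add)
open scoped Real ComplexConjugate

namespace Summit.RiemannHypothesis.RiemannHypothesis.Theorems.HandoffSemilocalParitySplit

variable {S : Finset ℕ} {g h e o k k₁ k₂ : ℝ → ℂ} {a : ℝ}

/-! ## §1  `W_S`: reflection invariance and additivity -/

/-- The `S`-restricted prime term is reflection invariant (it only involves `k(log n) + k(−log n)`). [folklore] -/
theorem weilSemilocalPrimeTerm_comp_neg (S : Finset ℕ) (k : ℝ → ℂ) :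
    weilSemilocalPrimeTerm S (fun t ↦ k (-t)) = weilSemilocalPrimeTerm S k := by
  unfold weilSemilocalPrimeTerm
  refine tsum_congr fun n ↦ ?_
  dsimp only
  rw [neg_neg, add_comm (k (-Real.log n))]

/-- **`W_S(k(−·)) = W_S(k)`** for every `k` (hypothesis-free). [cite: ConnesConsani2023, §2.1.3 (the even distribution), primes restricted to S] -/
theorem weilSemilocalFunctional_comp_neg (S : Finset ℕ) (k : ℝ → ℂ) :
    weilSemilocalFunctional S (fun t ↦ k (-t)) = weilSemilocalFunctional S k := by
  rw [weilSemilocalFunctional_eq_weilFunctional_add, weilSemilocalFunctional_eq_weilFunctional_add, weilFunctional_comp_neg, weilPrimeTerm_comp_neg,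
    weilSemilocalPrimeTerm_comp_neg]

/-- `Q_S(g(−·)) = Q_S(g)` (hypothesis-free). [folklore] -/
theorem weilSemilocalQuadratic_comp_neg (S : Finset ℕ) (g : ℝ → ℂ) :
    weilSemilocalQuadratic S (fun t ↦ g (-t)) = weilSemilocalQuadratic S g := by
  unfold weilSemilocalQuadratic
  rw [weilReflect_comp_neg, weilConv_comp_neg, weilSemilocalFunctional_comp_neg]

/-- A test function is bounded. [folklore] -/
theorem exists_norm_le_of_isWeilTest (hk : IsWeilTest k) : ∃ K : ℝ, ∀ x, ‖k x‖ ≤ K :=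
  hk.2.exists_bound_of_continuous hk.1.continuous

/-- The `S`-restricted prime term is additive on test kernels. [folklore] -/
theorem weilSemilocalPrimeTerm_add (S : Finset ℕ) (hk₁ : IsWeilTest k₁) (hk₂ : IsWeilTest k₂) :
    weilSemilocalPrimeTerm S (k₁ + k₂) = weilSemilocalPrimeTerm S k₁ + weilSemilocalPrimeTerm S k₂ := by
  obtain ⟨K₁, hK₁⟩ := exists_norm_le_of_isWeilTest hk₁
  obtain ⟨K₂, hK₂⟩ := exists_norm_le_of_isWeilTest hk₂
  unfold weilSemilocalPrimeTerm
  rw [← (summable_weilSemilocalPrimeTerm_summand S hK₁).tsum_add (summable_weilSemilocalPrimeTerm_summand S hK₂)]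
  refine tsum_congr fun n ↦ ?_
  simp only [Pi.add_apply]
  ring

/-- **Additivity of `W_S` on test kernels**: `W_S(k₁ + k₂) = W_S(k₁) + W_S(k₂)`. [folklore] -/
theorem weilSemilocalFunctional_add (S : Finset ℕ) (hk₁ : IsWeilTest k₁) (hk₂ : IsWeilTest k₂) :
    weilSemilocalFunctional S (k₁ + k₂) = weilSemilocalFunctional S k₁ + weilSemilocalFunctional S k₂ := by
  have hPr : weilPrimeTerm (k₁ + k₂) = weilPrimeTerm k₁ + weilPrimeTerm k₂ := by
    unfold weilPrimeTerm
    rw [← (summable_weilPrimeTerm hk₁.2).tsum_add (summable_weilPrimeTerm hk₂.2)]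
    refine tsum_congr fun n ↦ ?_
    simp only [Pi.add_apply]
    ring
  rw [weilSemilocalFunctional_eq_weilFunctional_add, weilSemilocalFunctional_eq_weilFunctional_add, weilSemilocalFunctional_eq_weilFunctional_add, weilFunctional_add hk₁ hk₂, hPr,
    weilSemilocalPrimeTerm_add S hk₁ hk₂]
  ring

/-! ## §2  Cross terms vanish: `Q_S` is parity-block-diagonal -/

/-- For `e` even and `o` odd: `W_S(e ⋆ õ) = 0` (the cross kernel is odd and `W_S` is reflection invariant). [cite: ConnesConsani2023, §2.1.3 Lemma 2.5 (iii), primes restricted to S] -/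
theorem weilSemilocalFunctional_weilConv_weilReflect_eq_zero_of_even_odd (S : Finset ℕ)
    (he : ∀ t, e (-t) = e t) (ho : ∀ t, o (-t) = -o t) :
    weilSemilocalFunctional S (weilConv e (weilReflect o)) = 0 := by
  have h1 : (fun t ↦ e (-t)) = e := funext he
  have h2 : (fun t ↦ o (-t)) = fun t ↦ (-1 : ℂ) * o t := funext fun t ↦ by rw [ho, neg_one_mul]
  have hodd : (fun t ↦ weilConv e (weilReflect o) (-t)) =
      fun t ↦ (-1 : ℂ) * weilConv e (weilReflect o) t := by
    rw [← weilConv_comp_neg, ← weilReflect_comp_neg, h1, h2, weilReflect_const_mul, map_neg, map_one,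
      weilConv_const_mul_right]
  have h := weilSemilocalFunctional_comp_neg S (weilConv e (weilReflect o))
  rw [hodd, weilSemilocalFunctional_const_mul] at h
  linear_combination (-1 / 2 : ℂ) * h

/-- Symmetric companion: `W_S(o ⋆ ẽ) = 0`. [cite: ConnesConsani2023, §2.1.3 Lemma 2.5 (iii), primes restricted to S] -/
theorem weilSemilocalFunctional_weilConv_weilReflect_eq_zero_of_odd_even (S : Finset ℕ)
    (ho : ∀ t, o (-t) = -o t) (he : ∀ t, e (-t) = e t) :
    weilSemilocalFunctional S (weilConv o (weilReflect e)) = 0 := by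
  have h1 : (fun t ↦ e (-t)) = e := funext he
  have h2 : (fun t ↦ o (-t)) = fun t ↦ (-1 : ℂ) * o t := funext fun t ↦ by rw [ho, neg_one_mul]
  have hodd : (fun t ↦ weilConv o (weilReflect e) (-t)) =
      fun t ↦ (-1 : ℂ) * weilConv o (weilReflect e) t := by
    rw [← weilConv_comp_neg, ← weilReflect_comp_neg, h1, h2, weilConv_const_mul_left]
  have h := weilSemilocalFunctional_comp_neg S (weilConv o (weilReflect e))
  rw [hodd, weilSemilocalFunctional_const_mul] at h
  linear_combination (-1 / 2 : ℂ) * h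

/-- **Polarisation of `Q_S` over a sum** of test functions: `Q_S(g + h) = Q_S(g) + Q_S(h) + (W_S(g ⋆ h̃) + W_S(h ⋆ g̃))`.
[cite: Bombieri2000Weil, §3 (the hermitian form), primes restricted to S] -/
theorem weilSemilocalQuadratic_add (S : Finset ℕ) (hg : IsWeilTest g) (hh : IsWeilTest h) :
    weilSemilocalQuadratic S (g + h) = weilSemilocalQuadratic S g + weilSemilocalQuadratic S h +
      (weilSemilocalFunctional S (weilConv g (weilReflect h)) + weilSemilocalFunctional S (weilConv h (weilReflect g))) := by
  have hg' := hg.weilReflect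
  have hh' := hh.weilReflect
  unfold weilSemilocalQuadratic
  rw [weilReflect_add, weilConv_add_left hg hh (hg'.add hh'), weilConv_add_right hg hg' hh',
    weilConv_add_right hh hg' hh',
    weilSemilocalFunctional_add S ((hg.weilConv hg').add (hg.weilConv hh')) ((hh.weilConv hg').add (hh.weilConv hh')),
    weilSemilocalFunctional_add S (hg.weilConv hg') (hg.weilConv hh'),
    weilSemilocalFunctional_add S (hh.weilConv hg') (hh.weilConv hh')]
  ring

/-- **`Q_S` is parity-block-diagonal**: `Q_S(e + o) = Q_S(e) + Q_S(o)` for test functions `e` even, `o` odd — `QW_λ = QW_λ⁺ ⊕ QW_λ⁻` at the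
places `S ∪ {∞}`. [cite: ConnesConsani2023, §2.1.3 eq. QW_λ = QW_λ⁺ ⊕ QW_λ⁻, primes restricted to S] -/
theorem weilSemilocalQuadratic_add_of_even_odd (S : Finset ℕ) (he : IsWeilTest e) (ho : IsWeilTest o)
    (hev : ∀ t, e (-t) = e t) (hodd : ∀ t, o (-t) = -o t) :
    weilSemilocalQuadratic S (e + o) = weilSemilocalQuadratic S e + weilSemilocalQuadratic S o := by
  rw [weilSemilocalQuadratic_add S he ho, weilSemilocalFunctional_weilConv_weilReflect_eq_zero_of_even_odd S hev hodd,
    weilSemilocalFunctional_weilConv_weilReflect_eq_zero_of_odd_even S hodd hev, add_zero, add_zero]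

/-- `Q_S(g) = Q_S(g_ev) + Q_S(g_od)` for the even and odd parts of a test function. [cite: ConnesConsani2023, §2.1.3, primes restricted to S] -/
theorem weilSemilocalQuadratic_eq_evenPart_add_oddPart (S : Finset ℕ) (hg : IsWeilTest g) :
    weilSemilocalQuadratic S g =
      weilSemilocalQuadratic S (fun t ↦ (g t + g (-t)) / 2) + weilSemilocalQuadratic S (fun t ↦ (g t - g (-t)) / 2) := by
  have hsum : g = (fun t ↦ (g t + g (-t)) / 2) + fun t ↦ (g t - g (-t)) / 2 := by
    funext t
    simp only [Pi.add_apply]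
    ring
  conv_lhs => rw [hsum]
  refine weilSemilocalQuadratic_add_of_even_odd S hg.evenPart hg.oddPart (fun t ↦ ?_) (fun t ↦ ?_)
  · simp only [neg_neg]
    ring
  · simp only [neg_neg]
    ring

/-! ## §3  The split of the semi-local ground energy and the sector certificate shapes -/

/-- A constrained sphere is a sub-sphere: `λ_min(S; a) ≤ λ_min(S; a; P)` whenever the `P`-sphere is nonempty. [folklore] -/
theorem semilocalGroundEnergy_top_le (S : Finset ℕ) (P : (ℝ → ℂ) → Prop) (hne : (semilocalSphereValues S P a).Nonempty) :
    semilocalGroundEnergy S (fun _ ↦ True) a ≤ semilocalGroundEnergy S P a := by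
  refine csInf_le_csInf (bddBelow_semilocalSphereValues S _ a) hne ?_
  rintro x ⟨g, hg, hs, -, hn, rfl⟩
  exact ⟨g, hg, hs, trivial, hn, rfl⟩

/-- `λ_min(S; a) ≤ λ_min(S; a; even)`. [folklore] -/
theorem semilocalGroundEnergy_le_even (S : Finset ℕ) (a : ℝ) :
    semilocalGroundEnergy S (fun _ ↦ True) a ≤ semilocalGroundEnergy S (fun g ↦ ∀ t, g (-t) = g t) a := by
  rcases le_or_gt a 0 with ha | ha
  · rw [semilocalGroundEnergy_of_nonpos S _ ha, semilocalGroundEnergy_of_nonpos S _ ha]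
  · exact semilocalGroundEnergy_top_le S _ (semilocalSphereValues_even_nonempty S ha)

/-- `λ_min(S; a) ≤ λ_min(S; a; odd)`. [folklore] -/
theorem semilocalGroundEnergy_le_odd (S : Finset ℕ) (a : ℝ) :
    semilocalGroundEnergy S (fun _ ↦ True) a ≤ semilocalGroundEnergy S (fun g ↦ ∀ t, g (-t) = -g t) a := by
  rcases le_or_gt a 0 with ha | ha
  · rw [semilocalGroundEnergy_of_nonpos S _ ha, semilocalGroundEnergy_of_nonpos S _ ha]
  · exact semilocalGroundEnergy_top_le S _ (semilocalSphereValues_odd_nonempty S ha)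

/-- **THE PARITY SPLIT of the semi-local ground energy**: `λ_min(S; a) = min(λ_min(S; a; even), λ_min(S; a; odd))` for every finite `S` and every
`a` (`≤`: sub-spheres; `≥`: `Q_S(g) = Q_S(g_ev) + Q_S(g_od)`, `‖g_ev‖² + ‖g_od‖² = 1`, and the two Rayleigh bounds). For `a ≤ 0` all three are the junk `0`.
[cite: Suzuki2026, §4.5 eq. (4.10) (arXiv p. 18), primes restricted to S; ConnesConsani2023 §2.1.3] -/
theorem semilocalGroundEnergy_eq_min_even_odd (S : Finset ℕ) (a : ℝ) :
    semilocalGroundEnergy S (fun _ ↦ True) a =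
      min (semilocalGroundEnergy S (fun g ↦ ∀ t, g (-t) = g t) a) (semilocalGroundEnergy S (fun g ↦ ∀ t, g (-t) = -g t) a) := by
  refine le_antisymm (le_min (semilocalGroundEnergy_le_even S a) (semilocalGroundEnergy_le_odd S a)) ?_
  rcases le_or_gt a 0 with ha | ha
  · rw [semilocalGroundEnergy_of_nonpos S _ ha, semilocalGroundEnergy_of_nonpos S _ ha, semilocalGroundEnergy_of_nonpos S _ ha, min_self]
  · refine le_semilocalGroundEnergy (semilocalSphereValues_top_nonempty S ha) fun g hg hs _ hn ↦ ?_
    set E : ℝ := semilocalGroundEnergy S (fun g ↦ ∀ t, g (-t) = g t) a with hE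
    set O : ℝ := semilocalGroundEnergy S (fun g ↦ ∀ t, g (-t) = -g t) a with hO
    have het : IsWeilTest fun t ↦ (g t + g (-t)) / 2 := hg.evenPart
    have hot : IsWeilTest fun t ↦ (g t - g (-t)) / 2 := hg.oddPart
    have hes : tsupport (fun t ↦ (g t + g (-t)) / 2) ⊆ Icc (-a) a :=
      tsupport_subset_Icc_of_symm hs fun s h1 h2 ↦ by simp only [h1, h2, add_zero, zero_div]
    have hos : tsupport (fun t ↦ (g t - g (-t)) / 2) ⊆ Icc (-a) a :=
      tsupport_subset_Icc_of_symm hs fun s h1 h2 ↦ by simp only [h1, h2, sub_zero, zero_div]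
    -- the Rayleigh bounds in the two sectors (positive multiples of an even/odd function are even/odd)
    have hEb : E * ∫ t, ‖(g t + g (-t)) / 2‖ ^ 2 ≤ (weilSemilocalQuadratic S fun t ↦ (g t + g (-t)) / 2).re :=
      semilocalGroundEnergy_mul_le_re het hes fun c _ t ↦ by
        show (c : ℂ) * ((g (-t) + g (- -t)) / 2) = (c : ℂ) * ((g t + g (-t)) / 2)
        rw [neg_neg, add_comm]
    have hOb : O * ∫ t, ‖(g t - g (-t)) / 2‖ ^ 2 ≤ (weilSemilocalQuadratic S fun t ↦ (g t - g (-t)) / 2).re :=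
      semilocalGroundEnergy_mul_le_re hot hos fun c _ t ↦ by
        show (c : ℂ) * ((g (-t) - g (- -t)) / 2) = -((c : ℂ) * ((g t - g (-t)) / 2))
        rw [neg_neg]
        ring
    set Ne : ℝ := ∫ t, ‖(g t + g (-t)) / 2‖ ^ 2 with hNe
    set No : ℝ := ∫ t, ‖(g t - g (-t)) / 2‖ ^ 2 with hNo
    have hNe0 : 0 ≤ Ne := integral_nonneg fun _ ↦ by positivity
    have hNo0 : 0 ≤ No := integral_nonneg fun _ ↦ by positivity
    have hsum : Ne + No = 1 := by rw [hNe, hNo, integral_norm_sq_evenPart_add_oddPart hg, hn]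
    have hQ : (weilSemilocalQuadratic S g).re =
        (weilSemilocalQuadratic S fun t ↦ (g t + g (-t)) / 2).re + (weilSemilocalQuadratic S fun t ↦ (g t - g (-t)) / 2).re := by
      rw [weilSemilocalQuadratic_eq_evenPart_add_oddPart S hg, Complex.add_re]
    have h1 : min E O * Ne ≤ E * Ne := mul_le_mul_of_nonneg_right (min_le_left _ _) hNe0
    have h2 : min E O * No ≤ O * No := mul_le_mul_of_nonneg_right (min_le_right _ _) hNo0
    calc min E O = min E O * Ne + min E O * No := by rw [← mul_add, hsum, mul_one]
      _ ≤ E * Ne + O * No := add_le_add h1 h2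
      _ ≤ (weilSemilocalQuadratic S fun t ↦ (g t + g (-t)) / 2).re +
            (weilSemilocalQuadratic S fun t ↦ (g t - g (-t)) / 2).re := add_le_add hEb hOb
      _ = (weilSemilocalQuadratic S g).re := hQ.symm

/-- **Sector form of the window's sign**: `0 ≤ λ_min(S; a) ↔ 0 ≤ λ_min(S; a; even) ∧ 0 ≤ λ_min(S; a; odd)`. [folklore] -/
theorem semilocalGroundEnergy_top_nonneg_iff_sectors (S : Finset ℕ) (a : ℝ) :
    0 ≤ semilocalGroundEnergy S (fun _ ↦ True) a ↔
      0 ≤ semilocalGroundEnergy S (fun g ↦ ∀ t, g (-t) = g t) a ∧ 0 ≤ semilocalGroundEnergy S (fun g ↦ ∀ t, g (-t) = -g t) a := by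
  rw [semilocalGroundEnergy_eq_min_even_odd, le_min_iff]

/-- **THE TWO-SECTOR CERTIFICATE SHAPE of a semi-local window**: `Q_S ≥ 0` on `C(a)` iff both sector bottoms are `≥ 0` — the shape of the A4
wall cells (even / free-odd certified separately). [cite: Yoshida1992HermitianForms, Prop. 6 (p. 320), primes restricted to S; this track (HANDOFF-STATEMENT §H.2)] -/
theorem weilSemilocalPositivityOn_iff_sectors (S : Finset ℕ) (a : ℝ) :
    WeilSemilocalPositivityOn S a ↔
      0 ≤ semilocalGroundEnergy S (fun g ↦ ∀ t, g (-t) = g t) a ∧ 0 ≤ semilocalGroundEnergy S (fun g ↦ ∀ t, g (-t) = -g t) a := by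
  rw [← semilocalGroundEnergy_top_nonneg_iff, semilocalGroundEnergy_top_nonneg_iff_sectors]

/-- LOWER clause of a wall cell from two sector certificates: `0 ≤ λ_ev(S; a)`, `0 ≤ λ_od(S; a)` ⟹ `a ≤ a*(S)`. [cite: Yoshida1992HermitianForms, Prop. 6 (p. 320), primes restricted to S] -/
theorem le_weilSemilocalThreshold_of_sector_energies (hev : 0 ≤ semilocalGroundEnergy S (fun g ↦ ∀ t, g (-t) = g t) a)
    (hod : 0 ≤ semilocalGroundEnergy S (fun g ↦ ∀ t, g (-t) = -g t) a) : a ≤ weilSemilocalThreshold S :=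
  semilocalGroundEnergy_top_nonneg_iff_le_threshold.1 ((semilocalGroundEnergy_top_nonneg_iff_sectors S a).2 ⟨hev, hod⟩)

/-- A negative unconstrained bottom puts the wall below the window: `λ_min(S; a) < 0 ⟹ a*(S) < a`. [cite: Yoshida1992HermitianForms, Prop. 6 (p. 320), primes restricted to S] -/
theorem weilSemilocalThreshold_lt_of_top_neg (h : semilocalGroundEnergy S (fun _ ↦ True) a < 0) :
    weilSemilocalThreshold S < a := by
  by_contra hle
  exact absurd (semilocalGroundEnergy_top_nonneg_iff_le_threshold.2 (not_lt.1 hle)) (not_le.2 h)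

/-- UPPER clause from ONE negative sector: `λ_od(S; a) < 0` ⟹ `a*(S) < a` (the free-odd wall cells alone bound `a*(S)` from above). [cite: Yoshida1992HermitianForms, Prop. 6 (p. 320), primes restricted to S] -/
theorem weilSemilocalThreshold_lt_of_odd_neg (hod : semilocalGroundEnergy S (fun g ↦ ∀ t, g (-t) = -g t) a < 0) :
    weilSemilocalThreshold S < a :=
  weilSemilocalThreshold_lt_of_top_neg ((semilocalGroundEnergy_le_odd S a).trans_lt hod)

/-- UPPER clause from the even sector alone: `λ_ev(S; a) < 0` ⟹ `a*(S) < a`. [cite: Yoshida1992HermitianForms, Prop. 6 (p. 320), primes restricted to S] -/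
theorem weilSemilocalThreshold_lt_of_even_neg (hev : semilocalGroundEnergy S (fun g ↦ ∀ t, g (-t) = g t) a < 0) :
    weilSemilocalThreshold S < a :=
  weilSemilocalThreshold_lt_of_top_neg ((semilocalGroundEnergy_le_even S a).trans_lt hev)

end Summit.RiemannHypothesis.RiemannHypothesis.Theorems.HandoffSemilocalParitySplit

end
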